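import Mathlib
import Literature.Combinatorics.Optimization.LpRelaxationsVersusSheraliAdams
import Literature.Combinatorics.Optimization.SheraliAdamsRandomRestriction
import Literature.Combinatorics.Optimization.LpGapFromSheraliAdamsGap
import Literature.Probability.Moments.ChangInequalityDensities
import Literature.Combinatorics.Optimization.SheraliAdamsAsLpRelaxation
import HarnessLib

/-!
# Chan–Lee–Raghavendra–Steurer, Theorems 3.1 and 3.2 — PROVED (§3.3 "Proof of Main Theorem")

Third brick: the printed proof of [ChanEtAl2016, §3.3, arXiv v3 p. 10–11] assembled from
`LPRelaxationsMaxCSP.lean` (Thm 2.3 "⇒": `LPRelaxation.Achieves.hasNonnegFactorization`),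
`Literature.Probability.Moments.ChangInequalityDensities` (Lemma 3.3, `ChanEtAl2016_lemma33_pow`),
and `SheraliAdamsRandomRestriction.lean` (Lemma 3.5 core, averaged restriction, junta averaging,
Lemma 2.4 / truncated functional).  THEOREMS ONLY (0 definitions, 0 named facts); discharges the two
facts of `LpRelaxationsVersusSheraliAdams.lean`:

* `sa_value_le_of_hasNonnegFactorization` — **the engine** (p. 10, eq. (3.1)–(3.3), nonnegative-rank
  form of §3.4): if `M^{n,𝒫}_{c,s} = Σ_{l<R} u_l v_lᵀ` with `u, v ≥ 0` and `R ≤ 2(√n)^d`, then for every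
  instance `ℑ₀` on `m ≤ n/4` variables with `opt ≤ s` and every degree-`d` pseudoexpectation `Ẽ`
  (`d ≥ max(1,k)`): `Ẽ[ℑ₀] ≤ c + c·B·(γ + R·2^{−t})` for all `t, γ > 0` with `γ² ≥ 16 m t d/√n`, where
  `B = #{α ⊆ [m] : |α| ≤ d}`.  Steps as printed: normalise the columns to densities `q_l` with
  weights `λ_l ≥ 0`, `Σ λ_l ≤ c` (expectation of (3.1)); `λ_l ≤ c 2^{−t}` off `Q_t = {l : q_l ≤ 2^t}`
  ((3.1) is pointwise `≤ c`); junta sets `J'_l` (Lemma 3.3) and a planting `S` with `|J'_l ∩ S| < d`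
  (Lemma 3.5); restrict (3.2) to `S` by averaging (`q_l^S`); split `q_l^S = q̃_l + e_l` with `q̃_l` a
  nonnegative `d`-junta and `|ê_l(α)| ≤ γ` on `|α| ≤ d`; apply the TRUNCATED functional (Lemma 2.4).
  Deviations (recorded): uniform `m`-subsets instead of Bernoulli sampling (Lemma 3.5); the bound is
  kept multiplicative in `c` (no `c ≤ 1` needed; `c ≥ 0` is forced); `d > m` is the trivial case
  `J = [m]`.
* `ChanEtAl2016_thm31_holds : ChanEtAl2016_thm31` — `t = d log₂ n`, `γ_n² = 16 m d² log₂ n/√n → 0`.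
* `ChanEtAl2016_thm32_holds : ChanEtAl2016_thm32` — `m = n`, `d = f(n)`, `N = n^{10 f(n)}`; the error is
  `≤ c(√(1280/n) + 4/n)` uniformly in `d` (p. 11).
* Unconditional corollaries (p. 9 "known Sherali–Adams gaps … imply the same integrality gaps for LPs
  of size n^{o(log n/log log n)}", abstract "7/8"): `poly_lp_of_linearSAGap`, `quasipoly_lp_of_linearSAGap`,
  and the instances `maxKSat_poly_lp` (no LP of size `n^{d/2}` `(1−ε, 1−2^{−k}+ε)`-approximates
  Max-`k`-SAT, `k ≥ 3`), `maxKXor_poly_lp`, `parityImplied_poly_lp`, fed by the tree's PROVED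
  `Schoenebeck2008_maxKSatSA`, `Schoenebeck2008_maxKXorSA`, `Schoenebeck2008_parityImplied_SA`.
* Both directions together (with §2.1 = `SheraliAdamsAsLpRelaxation.lean`, `SA_d` as an explicit LP of
  size `≤ (1 + n^d)² + 2`): `saAchieves_of_frequently_lp` (LPs of size `≤ n^{d/2}` achieving `(c,s)`
  for infinitely many `n` ⟹ `SA_d` achieves `(c,s)` for every `m`) and
  `poly_lp_everywhere_of_frequently_lp` (⟹ explicit LPs of size `≤ (1 + m^d)² + 2` achieve `(c,s)` for
  every `m`): polynomial-size LPs ≡ constant-round Sherali–Adams up to `n^{d/2} ↦ (1 + n^d)² + 2`.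
-/

noncomputable section

open Finset Filter Topology
open Literature.Probability.RandomGraphs.LowDegree (walsh)
open Literature.Computability.Complexity.LowDegree (cubeFourierCoeff)
open Literature.Probability.Moments (ChanEtAl2016_lemma33_pow)

namespace Literature.Combinatorics.Optimization

/-! ### Small helpers -/

/-- `(f − g)^(S) = f̂(S) − ĝ(S)`. [folklore] -/
private theorem cubeFourierCoeff_sub' {m : ℕ} (f g : (Fin m → Bool) → ℝ) (S : Finset (Fin m)) :
    cubeFourierCoeff (f - g) S = cubeFourierCoeff f S - cubeFourierCoeff g S := by
  unfold Literature.Computability.Complexity.LowDegree.cubeFourierCoeff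
  rw [← sub_div, ← sum_sub_distrib]
  congr 1
  exact sum_congr rfl fun x _ => by simp [sub_mul]

/-- "Cannot achieve" unfolded: an instance with `opt ≤ s` and a pseudoexpectation with `Ẽ[ℑ] > c`.
[cite: ChanEtAl2016, §2.1 (arXiv v3 p. 8, eq. (sa-opt))] -/
private theorem exists_of_not_saAchieves {k n d : ℕ} {P : Set ((Fin k → Bool) → Bool)} {c s : ℝ}
    (h : ¬ SAAchieves (n := n) P d c s) :
    ∃ I : CSPInstance k n P, I.OptLE s ∧ ∃ pE : SAPseudoexpectation n d, c < pE.E I.val := by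
  simp only [SAAchieves, not_forall, not_le] at h
  obtain ⟨I, hI, pE, hlt⟩ := h
  exact ⟨I, hI, pE, hlt⟩

/-! ### The engine: §3.3 for a nonnegative factorisation of `M^{n,𝒫}_{c,s}` -/

/-- **CLRS §3.3 (eq. (3.1)–(3.3)), nonnegative-rank form.**  Let `M^{n,𝒫}_{c,s}(ℑ, x) = c − ℑ(x)`
have a nonnegative factorisation of size `R ≤ 2(√n)^d`, let `1 ≤ d`, `k ≤ d`, `1 ≤ m`, `4m ≤ n`, and
let `t, γ > 0` with `γ² ≥ 16 m t d/√n`.  Then for every instance `ℑ₀` of Max-`𝒫` on `m` variables with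
`opt(ℑ₀) ≤ s` and every degree-`d` Sherali–Adams pseudoexpectation `Ẽ`:
`Ẽ[ℑ₀] ≤ c + c · #{α ⊆ [m] : |α| ≤ d} · (γ + R · 2^{−t})`
(the printed `𝓛(ℑ_S) − SA_d(ℑ₀) ≥ −\binom{m}{≤d}(16mtd/√n)^{1/2} − \binom{m}{≤d} n^{d/2} 2^{−t}`).
[cite: ChanEtAl2016, §3.3 (arXiv v3 p. 10–11) and §3.4 (p. 11)] -/
theorem sa_value_le_of_hasNonnegFactorization
    {k m n d R : ℕ} {P : Set ((Fin k → Bool) → Bool)} {c s t γ : ℝ}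
    (hd : 1 ≤ d) (hkd : k ≤ d) (hm : 1 ≤ m) (h4m : 4 * m ≤ n)
    (ht : 0 < t) (hγ : 0 < γ) (hγt : 16 * m * t * d / Real.sqrt n ≤ γ ^ 2)
    (hR : (R : ℝ) ≤ 2 * Real.sqrt n ^ d)
    (hfac : HasNonnegFactorization (cspMatrix k n P c s) R)
    (I : CSPInstance k m P) (hI : I.OptLE s) (pE : SAPseudoexpectation m d) :
    pE.E I.val ≤ c + c * ((univ.filter fun S : Finset (Fin m) => S.card ≤ d).card : ℝ) *
      (γ + R * (2 : ℝ) ^ (-t)) := by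
  classical
  obtain ⟨U, V, hU, hV, hUV⟩ := hfac
  have hmn : m ≤ n := by omega
  have hn0 : (0 : ℝ) < n := by exact_mod_cast (show 0 < n by omega)
  have hm0 : (0 : ℝ) < m := by exact_mod_cast (show 0 < m by omega)
  have hsq0 : 0 < Real.sqrt n := Real.sqrt_pos.2 hn0
  have h2n : (0 : ℝ) < 2 ^ n := by positivity
  set B : ℝ := ((univ.filter fun S : Finset (Fin m) => S.card ≤ d).card : ℝ) with hB
  have hB0 : 0 ≤ B := Nat.cast_nonneg _
  have h2t : 0 < (2 : ℝ) ^ (-t) := Real.rpow_pos_of_pos two_pos _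
  -- Step 1: normalise the columns to densities `q_l`
  set μ : Fin R → ℝ := fun l => (∑ x, V l x) / 2 ^ n with hμ
  have hμ0 : ∀ l, 0 ≤ μ l := fun l => div_nonneg (sum_nonneg fun x _ => hV l x) h2n.le
  set q : Fin R → (Fin n → Bool) → ℝ := fun l x => if μ l = 0 then 1 else V l x / μ l with hq
  have hq0 : ∀ l x, 0 ≤ q l x := by
    intro l x; simp only [hq]
    split_ifs with h
    · exact zero_le_one
    · exact div_nonneg (hV l x) (hμ0 l)
  have hq1 : ∀ l, ∑ x, q l x = (2 : ℝ) ^ n := by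
    intro l; simp only [hq]
    split_ifs with h
    · simp
    · rw [← sum_div, div_eq_iff h, hμ]; field_simp
  have hVq : ∀ l x, V l x = μ l * q l x := by
    intro l x; simp only [hq]
    split_ifs with h
    · -- `μ_l = 0` forces `V_l ≡ 0`
      have hsum : ∑ y, V l y = 0 := by
        have := h; rw [hμ, div_eq_zero_iff] at this
        exact this.resolve_right h2n.ne'
      have := (sum_eq_zero_iff_of_nonneg fun y _ => hV l y).1 hsum x (mem_univ x)
      rw [this, h, zero_mul]
    · field_simp
  -- the columns of small sup-norm
  let good : Fin R → Prop := fun l => ∀ x, q l x ≤ (2 : ℝ) ^ t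
  -- Step 2: junta sets on `{0,1}^n` (Lemma 3.3), of size `≤ √n/(8m)`
  have hJbound : 2 * t * d / γ ^ 2 ≤ Real.sqrt n / (8 * m) := by
    have hpos : 0 < 16 * m * t * d / Real.sqrt n := by positivity
    calc 2 * t * d / γ ^ 2 ≤ 2 * t * d / (16 * m * t * d / Real.sqrt n) :=
          div_le_div_of_nonneg_left (by positivity) hpos hγt
      _ = Real.sqrt n / (8 * m) := by field_simp; ring
  have hJ' : ∀ l, ∃ J' : Finset (Fin n), (J'.card : ℝ) ≤ Real.sqrt n / (8 * m) ∧
      (good l → ∀ α : Finset (Fin n), α.card ≤ d → ¬ α ⊆ J' → |cubeFourierCoeff (q l) α| ≤ γ) := by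
    intro l
    by_cases hg : good l
    · obtain ⟨J', hJ'card, hJ'⟩ := ChanEtAl2016_lemma33_pow (hq0 l) (hq1 l) ht.le hg d hγ
      exact ⟨J', hJ'card.trans hJbound, fun _ => hJ'⟩
    · exact ⟨∅, by simp; positivity, fun h => absurd h hg⟩
  choose J' hJ'card hJ'good using hJ'
  -- Step 3: the planting `e : [m] ↪ [n]` and junta sets `J_l ⊆ [m]`, `|J_l| ≤ d` (Lemma 3.5)
  have hS : ∃ (e : Fin m ↪ Fin n) (J : Fin R → Finset (Fin m)), (∀ l, (J l).card ≤ d) ∧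
      ∀ l, good l → ∀ α : Finset (Fin m), α.card ≤ d → ¬ α ⊆ J l →
        |cubeFourierCoeff (q l) (α.map e)| ≤ γ := by
    by_cases hdm : d ≤ m
    · obtain ⟨S, hScard, hSJ⟩ := exists_subset_small_meet hd hdm h4m J' hJ'card hR
      set e : Fin m ↪ Fin n := (S.orderEmbOfFin hScard).toEmbedding with he
      have hemem : ∀ i, e i ∈ S := fun i => S.orderEmbOfFin_mem hScard i
      refine ⟨e, fun l => univ.filter fun i => e i ∈ J' l, fun l => ?_, fun l hg α hα hαJ => ?_⟩
      · have hsub : ((univ.filter fun i : Fin m => e i ∈ J' l).map e) ⊆ J' l ∩ S := by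
          intro j hj
          rw [Finset.mem_map] at hj
          obtain ⟨i, hi, rfl⟩ := hj
          exact mem_inter.2 ⟨(mem_filter.1 hi).2, hemem i⟩
        have h := card_le_card hsub
        rw [card_map] at h
        exact h.trans (hSJ l).le
      · refine hJ'good l hg (α.map e) (by rwa [card_map]) fun hsub => hαJ fun i hi => ?_
        exact mem_filter.2 ⟨mem_univ _, hsub (mem_map_of_mem e hi)⟩
    · push Not at hdm
      refine ⟨Fin.castLEEmb hmn, fun _ => univ, fun l => ?_, fun l hg α hα hαJ => absurd (subset_univ α) hαJ⟩
      rw [card_univ, Fintype.card_fin]; exact hdm.le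
  obtain ⟨e, J, hJd, hJγ⟩ := hS
  -- Step 4: the factorisation row of the planted instance, eq. (3.1)/(3.2)
  set IS : SoundInstances k n P s := ⟨I.plant e, hI.plant e⟩ with hIS
  set lam : Fin R → ℝ := fun l => U IS l * μ l with hlam
  have hlam0 : ∀ l, 0 ≤ lam l := fun l => mul_nonneg (hU IS l) (hμ0 l)
  have hrow : ∀ x : Fin n → Bool, c - I.val (x ∘ e) = ∑ l, lam l * q l x := by
    intro x
    have h := hUV IS x
    simp only [cspMatrix, hIS, CSPInstance.plant_val] at h
    rw [h]
    exact sum_congr rfl fun l _ => by rw [hVq]; ring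
  -- `Σ λ_l ≤ c` and `c ≥ 0` (expectation of (3.1))
  have hsumlam : ∑ l, lam l ≤ c ∧ 0 ≤ c := by
    have hx : ∑ x : Fin n → Bool, (c - I.val (x ∘ e)) = (∑ l, lam l) * 2 ^ n := by
      rw [sum_congr rfl fun x _ => hrow x, sum_comm, sum_mul]
      exact sum_congr rfl fun l _ => by rw [← mul_sum, hq1]
    have hv0 : 0 ≤ ∑ x : Fin n → Bool, I.val (x ∘ e) := sum_nonneg fun x _ => I.val_nonneg _
    have hcard : ∑ _x : Fin n → Bool, c = c * 2 ^ n := by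
      rw [sum_const, card_univ, Fintype.card_fun, Fintype.card_bool, Fintype.card_fin, nsmul_eq_mul]
      push_cast; ring
    rw [sum_sub_distrib, hcard] at hx
    have hl0 : 0 ≤ ∑ l, lam l := sum_nonneg fun l _ => hlam0 l
    constructor <;> nlinarith
  obtain ⟨hsumlam, hc0⟩ := hsumlam
  -- bad columns carry weight `≤ c 2^{−t}`
  have hbad : ∀ l, ¬ good l → lam l ≤ c * (2 : ℝ) ^ (-t) := by
    intro l hg
    simp only [good, not_forall, not_le] at hg
    obtain ⟨x, hx⟩ := hg
    have h1 : lam l * q l x ≤ c - I.val (x ∘ e) := by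
      rw [hrow x]
      exact single_le_sum (f := fun l' => lam l' * q l' x)
        (fun l' _ => mul_nonneg (hlam0 l') (hq0 l' x)) (mem_univ l)
    have h2 : c - I.val (x ∘ e) ≤ c := by linarith [I.val_nonneg (x ∘ e)]
    have h3 : lam l * (2 : ℝ) ^ t ≤ c :=
      (mul_le_mul_of_nonneg_left hx.le (hlam0 l)).trans (h1.trans h2)
    rw [Real.rpow_neg zero_le_two, ← div_eq_mul_inv, le_div_iff₀ (Real.rpow_pos_of_pos two_pos t)]
    exact h3
  -- Step 5: restrict to `S` by averaging
  set qS : Fin R → (Fin m → Bool) → ℝ := fun l => avgRestrict e (q l) with hqS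
  have hqS0 : ∀ l y, 0 ≤ qS l y := fun l y => avgRestrict_nonneg e (hq0 l) y
  have hqS1 : ∀ l, ∑ y, qS l y = (2 : ℝ) ^ m := fun l => sum_avgRestrict_of_density e (hq1 l)
  have hrowS : ∀ y, c - I.val y = ∑ l, lam l * qS l y :=
    eq_sum_avgRestrict_of_forall e univ lam q (fun y => c - I.val y) hrow
  have hcoefS : ∀ l, good l → ∀ α : Finset (Fin m), α.card ≤ d → ¬ α ⊆ J l →
      |cubeFourierCoeff (qS l) α| ≤ γ := by
    intro l hg α hα hαJ
    rw [hqS, cubeFourierCoeff_avgRestrict]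
    exact hJγ l hg α hα hαJ
  -- Step 6: the truncated functional applied to (3.2)
  have hval : pE.truncate.E I.val = pE.E I.val :=
    pE.truncate_E_of_hasDegreeLE (I.hasDegreeLE_val.mono hkd)
  have hE : c - pE.E I.val = ∑ l, lam l * pE.truncate.E (qS l) := by
    have hfun : (fun y => c - I.val y) = ∑ l, lam l • qS l := by
      funext y; rw [hrowS y, Finset.sum_apply]
      simp only [Pi.smul_apply, smul_eq_mul]
    have hcf : (fun y => c - I.val y) = (fun _ => c) - I.val := by funext y; simp
    have h := congrArg pE.truncate.E hfun
    rw [map_sum, hcf, map_sub, SAPseudoexpectation.map_const, hval] at h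
    rw [h]
    exact sum_congr rfl fun l _ => by rw [map_smul, smul_eq_mul]
  -- good columns: junta part `≥ 0`, error part `≥ −γB`
  have hgoodE : ∀ l, good l → -(γ * B) ≤ pE.truncate.E (qS l) := by
    intro l hg
    have hjunta : IsJunta d (avgOutside (J l) (qS l)) := (isJunta_avgOutside (J l) (qS l)).mono (hJd l)
    have hqt0 : 0 ≤ pE.truncate.E (avgOutside (J l) (qS l)) :=
      pE.truncate.nonneg _ hjunta (avgOutside_nonneg _ (hqS0 l))
    have herr : |pE.truncate.E (qS l - avgOutside (J l) (qS l))| ≤ γ * B := by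
      refine pE.abs_truncate_E_le_mul_card fun S hS => ?_
      rw [cubeFourierCoeff_sub', cubeFourierCoeff_avgOutside]
      split_ifs with hSJ
      · rw [sub_self, abs_zero]; exact hγ.le
      · rw [sub_zero]; exact hcoefS l hg S hS hSJ
    have hsplit : pE.truncate.E (qS l) =
        pE.truncate.E (avgOutside (J l) (qS l)) + pE.truncate.E (qS l - avgOutside (J l) (qS l)) := by
      rw [map_sub]; ring
    rw [hsplit]
    linarith [neg_abs_le (pE.truncate.E (qS l - avgOutside (J l) (qS l)))]
  -- all columns: `≥ −B`
  have hallE : ∀ l, -B ≤ pE.truncate.E (qS l) := fun l => by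
    have := pE.abs_truncate_E_le_card (hqS0 l) (hqS1 l)
    linarith [neg_abs_le (pE.truncate.E (qS l))]
  -- Step 7: sum up
  have hterm : ∀ l, -(γ * B) * lam l - B * (c * (2 : ℝ) ^ (-t)) ≤ lam l * pE.truncate.E (qS l) := by
    intro l
    by_cases hg : good l
    · have h := mul_le_mul_of_nonneg_left (hgoodE l hg) (hlam0 l)
      have : 0 ≤ B * (c * (2 : ℝ) ^ (-t)) := mul_nonneg hB0 (mul_nonneg hc0 h2t.le)
      linarith
    · have h1 := mul_le_mul_of_nonneg_left (hallE l) (hlam0 l)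
      have h2 : lam l * B ≤ c * (2 : ℝ) ^ (-t) * B := mul_le_mul_of_nonneg_right (hbad l hg) hB0
      have h3 : 0 ≤ γ * B * lam l := mul_nonneg (mul_nonneg hγ.le hB0) (hlam0 l)
      linarith
  have hsum : -(γ * B) * (∑ l, lam l) - R * (B * (c * (2 : ℝ) ^ (-t))) ≤
      ∑ l, lam l * pE.truncate.E (qS l) := by
    have h := sum_le_sum fun l (_ : l ∈ (univ : Finset (Fin R))) => hterm l
    rw [sum_sub_distrib, ← mul_sum, sum_const, card_univ, Fintype.card_fin, nsmul_eq_mul] at h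
    exact h
  have hγB : -(γ * B) * (∑ l, lam l) ≥ -(γ * B) * c := by nlinarith [mul_nonneg hγ.le hB0]
  rw [← hE] at hsum
  nlinarith [hsum, hγB]

/-! ### Theorem 3.1 -/

/-- `n^{d/2} = (√n)^d`. [folklore] -/
private theorem rpow_half_eq_sqrt_pow (n d : ℕ) : (n : ℝ) ^ ((d : ℝ) / 2) = Real.sqrt n ^ d := by
  rw [Real.sqrt_eq_rpow, ← Real.rpow_natCast, ← Real.rpow_mul (Nat.cast_nonneg n)]
  congr 1; ring

/-- The error term of Theorem 3.1 tends to `0`: `√(16 m d² log₂ n/√n) + 2 n^{−d/2} → 0` (`d ≥ 1`).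
[cite: ChanEtAl2016, §3.3 (arXiv v3 p. 11, eq. (eta): "η_n = O(m^d √(md log n)/n^{1/4}) … → 0")] -/
private theorem tendsto_err (m d : ℕ) (hd : 1 ≤ d) :
    Tendsto (fun n : ℕ => Real.sqrt (16 * m * (d * Real.logb 2 n) * d / Real.sqrt n) +
      2 * (n : ℝ) ^ (-((d : ℝ) / 2))) atTop (𝓝 0) := by
  have hnat : Tendsto (fun n : ℕ => (n : ℝ)) atTop atTop := tendsto_natCast_atTop_atTop
  -- `log n / n^{1/2} → 0`
  have h1 : Tendsto (fun n : ℕ => Real.log n / (n : ℝ) ^ (1 / 2 : ℝ)) atTop (𝓝 0) :=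
    ((isLittleO_log_rpow_atTop (by norm_num : (0 : ℝ) < 1 / 2)).tendsto_div_nhds_zero).comp hnat
  have h2 : Tendsto (fun n : ℕ => 16 * m * (d * Real.logb 2 n) * d / Real.sqrt n) atTop (𝓝 0) := by
    have h := h1.const_mul (16 * m * d * d / Real.log 2)
    rw [mul_zero] at h
    refine h.congr fun n => ?_
    rw [Real.logb, Real.sqrt_eq_rpow]
    field_simp
  have h3 : Tendsto (fun n : ℕ => Real.sqrt (16 * m * (d * Real.logb 2 n) * d / Real.sqrt n))
      atTop (𝓝 0) := by
    have h := (Real.continuous_sqrt.tendsto 0).comp h2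
    rwa [Real.sqrt_zero] at h
  have h4 : Tendsto (fun n : ℕ => 2 * (n : ℝ) ^ (-((d : ℝ) / 2))) atTop (𝓝 0) := by
    have h := ((tendsto_rpow_neg_atTop (by positivity : (0 : ℝ) < d / 2)).comp hnat).const_mul 2
    rw [mul_zero] at h
    exact h
  have h := h3.add h4
  rwa [add_zero] at h

/-- **Chan–Lee–Raghavendra–Steurer, Theorem 3.1 (Main) — PROVED.**  Discharges the named fact
`ChanEtAl2016_thm31` (net debt −1). [cite: ChanEtAl2016, Thm 3.1 (arXiv v3 p. 9; proof §3.3 p. 10–11)] -/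
theorem ChanEtAl2016_thm31_holds : ChanEtAl2016_thm31 := by
  classical
  intro k d P c s hd hkd m hSA
  obtain ⟨I, hI, pE, hgap⟩ := exists_of_not_saAchieves hSA
  rcases Nat.eq_zero_or_pos m with hm0 | hm
  · -- no variables: `ℑ` is a constant `v > c` with `v ≤ s`; every planted copy defeats every LP
    subst hm0
    have hconst : I.val = fun _ => I.val (fun i => i.elim0) := by
      funext x; congr 1; funext i; exact i.elim0
    have hv : c < I.val (fun i => i.elim0) := by
      rw [hconst, SAPseudoexpectation.map_const] at hgap; exact hgap
    refine ⟨0, fun n _ R _ L hL => ?_⟩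
    let e : Fin 0 ↪ Fin n := ⟨fun i => i.elim0, fun i => i.elim0⟩
    have h := (hL (I.plant e) (hI.plant e)).val_le (fun _ => false)
    rw [CSPInstance.plant_val] at h
    have : I.val ((fun _ => false) ∘ e) = I.val (fun i => i.elim0) := by rw [hconst]
    linarith
  -- `m ≥ 1`: the engine with `t = d log₂ n`, `γ_n² = 16 m t d/√n`
  set B : ℝ := ((univ.filter fun S : Finset (Fin m) => S.card ≤ d).card : ℝ) with hB
  have hB0 : 0 ≤ B := Nat.cast_nonneg _
  set δ : ℝ := pE.E I.val - c with hδ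
  have hδ0 : 0 < δ := by rw [hδ]; linarith
  have hlim := (tendsto_err m d hd).const_mul (|c| * B)
  rw [mul_zero] at hlim
  obtain ⟨n₁, hn₁⟩ := eventually_atTop.1 (hlim.eventually_lt_const hδ0)
  refine ⟨max n₁ (4 * m), fun n hn R hR L hL => ?_⟩
  have hn₁n : n₁ ≤ n := le_trans (le_max_left _ _) hn
  have h4m : 4 * m ≤ n := le_trans (le_max_right _ _) hn
  have hn2 : (2 : ℝ) ≤ n := by exact_mod_cast (show 2 ≤ n by omega)
  have hn0 : (0 : ℝ) < n := by linarith
  have hn1 : (1 : ℝ) < n := by linarith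
  have hsq1 : 1 ≤ Real.sqrt n := by
    rw [Real.le_sqrt zero_le_one hn0.le]; linarith
  -- parameters
  set t : ℝ := d * Real.logb 2 n with ht
  have hlog : 0 < Real.logb 2 n := Real.logb_pos one_lt_two hn1
  have ht0 : 0 < t := by rw [ht]; exact mul_pos (by exact_mod_cast hd) hlog
  have hin : 0 < 16 * m * t * d / Real.sqrt n := by
    have : (0 : ℝ) < m := by exact_mod_cast hm
    have : (0 : ℝ) < d := by exact_mod_cast hd
    positivity
  set γ : ℝ := Real.sqrt (16 * m * t * d / Real.sqrt n) with hγ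
  have hγ0 : 0 < γ := Real.sqrt_pos.2 hin
  have hγt : 16 * m * t * d / Real.sqrt n ≤ γ ^ 2 := by rw [hγ, Real.sq_sqrt hin.le]
  -- the factorisation of size `R + 1 ≤ 2 (√n)^d`
  have hfac := hL.hasNonnegFactorization
  have hRsq : (R : ℝ) ≤ Real.sqrt n ^ d := by rw [← rpow_half_eq_sqrt_pow]; exact hR
  have hsqd : 1 ≤ Real.sqrt n ^ d := one_le_pow₀ hsq1
  have hR' : ((R + 1 : ℕ) : ℝ) ≤ 2 * Real.sqrt n ^ d := by push_cast; linarith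
  have key := sa_value_le_of_hasNonnegFactorization hd hkd hm h4m ht0 hγ0 hγt hR' hfac I hI pE
  -- `(R+1) 2^{−t} ≤ 2 n^{−d/2}`
  have h2t : (2 : ℝ) ^ (-t) = (n : ℝ) ^ (-(d : ℝ)) := by
    rw [ht, show -(↑d * Real.logb 2 ↑n) = Real.logb 2 n * (-(d : ℝ)) by ring,
      Real.rpow_mul zero_le_two, Real.rpow_logb two_pos (by norm_num) hn0]
  have hRt : ((R + 1 : ℕ) : ℝ) * (2 : ℝ) ^ (-t) ≤ 2 * (n : ℝ) ^ (-((d : ℝ) / 2)) := by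
    rw [h2t]
    have hnd : 0 < (n : ℝ) ^ (-(d : ℝ)) := Real.rpow_pos_of_pos hn0 _
    calc ((R + 1 : ℕ) : ℝ) * (n : ℝ) ^ (-(d : ℝ)) ≤ 2 * Real.sqrt n ^ d * (n : ℝ) ^ (-(d : ℝ)) :=
          mul_le_mul_of_nonneg_right hR' hnd.le
      _ = 2 * ((n : ℝ) ^ ((d : ℝ) / 2) * (n : ℝ) ^ (-(d : ℝ))) := by rw [rpow_half_eq_sqrt_pow]; ring
      _ = 2 * (n : ℝ) ^ (-((d : ℝ) / 2)) := by
          rw [← Real.rpow_add hn0]; congr 1; ring_nf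
  -- the error is below `δ` for `n ≥ n₁`
  have herr := hn₁ n hn₁n
  have hg0 : 0 ≤ γ + ((R + 1 : ℕ) : ℝ) * (2 : ℝ) ^ (-t) := by positivity
  have hmain : c * B * (γ + ((R + 1 : ℕ) : ℝ) * (2 : ℝ) ^ (-t)) < δ := by
    calc c * B * (γ + ((R + 1 : ℕ) : ℝ) * (2 : ℝ) ^ (-t))
        ≤ |c| * B * (γ + ((R + 1 : ℕ) : ℝ) * (2 : ℝ) ^ (-t)) := by
          gcongr; exact le_abs_self c
      _ ≤ |c| * B * (Real.sqrt (16 * m * (d * Real.logb 2 n) * d / Real.sqrt n) +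
            2 * (n : ℝ) ^ (-((d : ℝ) / 2))) := by
          refine mul_le_mul_of_nonneg_left ?_ (mul_nonneg (abs_nonneg c) hB0)
          have : γ = Real.sqrt (16 * m * (d * Real.logb 2 n) * d / Real.sqrt n) := by
            rw [hγ, ht]
          rw [← this]; linarith
      _ < δ := herr
  have : pE.E I.val < pE.E I.val := by
    calc pE.E I.val ≤ c + c * B * (γ + ((R + 1 : ℕ) : ℝ) * (2 : ℝ) ^ (-t)) := key
      _ < c + δ := by linarith
      _ = pE.E I.val := by rw [hδ]; ring
  exact lt_irrefl _ this

/-! ### Unconditional corollaries: polynomial-size LPs versus linear-round Sherali–Adams gaps -/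

/-- **Polynomial-size LP relaxations do not beat linear-round Sherali–Adams gaps (UNCONDITIONAL).**
If for every `ε > 0` the `⌊c_ε n⌋`-round Sherali–Adams relaxation of Max-`𝒫` fails to
`(1 − ε, s₀ + ε)`-approximate for all large `n`, then for every `ε > 0` and `d ≥ max(1,k)`: for all
large `n`, no LP relaxation of size `R ≤ n^{d/2}` achieves a `(1 − ε, s₀ + ε)`-approximation on
`n`-variable instances. [cite: ChanEtAl2016, Thm 3.1 (arXiv v3 p. 9) and §3 (p. 9: "known Sherali–Adams gaps … imply the same integrality gaps for LPs")] -/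
theorem poly_lp_of_linearSAGap {k : ℕ} (P : Set ((Fin k → Bool) → Bool)) {s₀ : ℝ}
    (hSAgap : ∀ ε : ℝ, 0 < ε → ∃ cε : ℝ, 0 < cε ∧ ∃ n₀ : ℕ, ∀ n : ℕ, n₀ ≤ n →
      ¬ SAAchieves (n := n) P ⌊cε * n⌋₊ (1 - ε) (s₀ + ε))
    {ε : ℝ} (hε : 0 < ε) {d : ℕ} (hd : 1 ≤ d) (hkd : k ≤ d) :
    ∃ n₀ : ℕ, ∀ n : ℕ, n₀ ≤ n → ∀ R : ℕ, (R : ℝ) ≤ (n : ℝ) ^ ((d : ℝ) / 2) →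
      ∀ L : LPRelaxation k n P R, ¬ L.Achieves (1 - ε) (s₀ + ε) :=
  ChanEtAl2016_thm31_holds.poly_of_linearSAGap P hSAgap hε hd hkd

/-- **Max-`k`-SAT (`k ≥ 3`): polynomial-size LPs have integrality gap `1 − 2^{−k}`** — "any such linear
program for Max 3-Sat has an integrality gap of 7/8" (abstract), UNCONDITIONAL (Thm 3.1 +
`Schoenebeck2008_maxKSatSA`): for every `ε > 0` and `d ≥ k`, for all large `n`, no LP relaxation of
size `≤ n^{d/2}` achieves a `(1 − ε, 1 − 2^{−k} + ε)`-approximation.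
[cite: ChanEtAl2016, abstract and §3 (arXiv v3 p. 1, 9)] -/
theorem maxKSat_poly_lp {k : ℕ} (hk : 3 ≤ k) {ε : ℝ} (hε : 0 < ε) {d : ℕ} (hkd : k ≤ d) :
    ∃ n₀ : ℕ, ∀ n : ℕ, n₀ ≤ n → ∀ R : ℕ, (R : ℝ) ≤ (n : ℝ) ^ ((d : ℝ) / 2) →
      ∀ L : LPRelaxation k n (maxKSatPreds k) R, ¬ L.Achieves (1 - ε) (1 - 1 / 2 ^ k + ε) :=
  poly_lp_of_linearSAGap (maxKSatPreds k) (Schoenebeck2008_maxKSatSA hk) hε (by omega) hkd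

/-- **Max-`k`-XOR (`k ≥ 3`): polynomial-size LPs have integrality gap `1/2`**, UNCONDITIONAL
(Thm 3.1 + `Schoenebeck2008_maxKXorSA`). [cite: ChanEtAl2016, §3 (arXiv v3 p. 9)] -/
theorem maxKXor_poly_lp {k : ℕ} (hk : 3 ≤ k) {ε : ℝ} (hε : 0 < ε) {d : ℕ} (hkd : k ≤ d) :
    ∃ n₀ : ℕ, ∀ n : ℕ, n₀ ≤ n → ∀ R : ℕ, (R : ℝ) ≤ (n : ℝ) ^ ((d : ℝ) / 2) →
      ∀ L : LPRelaxation k n (literalClosure (xorK k)) R, ¬ L.Achieves (1 - ε) (1 / 2 + ε) :=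
  poly_lp_of_linearSAGap _ (Schoenebeck2008_maxKXorSA hk) hε (by omega) hkd

/-- **Every parity-implied Max-`k`-CSP (`k ≥ 3`): polynomial-size LPs do not beat the random
assignment threshold `|P⁻¹(1)|/2^k`**, UNCONDITIONAL (Thm 3.1 + `Schoenebeck2008_parityImplied_SA`).
[cite: ChanEtAl2016, §3 (arXiv v3 p. 9) with §1.1 (p. 4: "Sherali–Adams integrality gaps for CSPs with a pairwise independent predicate [BGMT12]")] -/
theorem parityImplied_poly_lp {k : ℕ} (hk : 3 ≤ k) {Q : (Fin k → Bool) → Bool}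
    (hQ : ∀ y, xorK k y = true → Q y = true) {ε : ℝ} (hε : 0 < ε) {d : ℕ} (hkd : k ≤ d) :
    ∃ n₀ : ℕ, ∀ n : ℕ, n₀ ≤ n → ∀ R : ℕ, (R : ℝ) ≤ (n : ℝ) ^ ((d : ℝ) / 2) →
      ∀ L : LPRelaxation k n (literalClosure Q) R, ¬ L.Achieves (1 - ε)
        (((univ : Finset (Fin k → Bool)).filter fun y => Q y = true).card / 2 ^ k + ε) :=
  poly_lp_of_linearSAGap _ (Schoenebeck2008_parityImplied_SA hk hQ) hε (by omega) hkd

/-! ### Theorem 3.2 -/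

/-- `d³ · n ≤ n^d` for `n ≥ 8`, `d ≥ 1` (the polynomial-versus-exponential bookkeeping of p. 11).
[folklore] -/
private theorem cube_mul_le_pow {n : ℕ} (hn : 8 ≤ n) {d : ℕ} (hd : 1 ≤ d) : d ^ 3 * n ≤ n ^ d := by
  induction d, hd using Nat.le_induction with
  | base => simp
  | succ d hd ih =>
    have h1 : (d + 1) ^ 3 ≤ 8 * d ^ 3 := by
      have : d + 1 ≤ 2 * d := by omega
      calc (d + 1) ^ 3 ≤ (2 * d) ^ 3 := Nat.pow_le_pow_left this 3
        _ = 8 * d ^ 3 := by ring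
    calc (d + 1) ^ 3 * n ≤ 8 * d ^ 3 * n := Nat.mul_le_mul_right n h1
      _ = 8 * (d ^ 3 * n) := by ring
      _ ≤ n * n ^ d := Nat.mul_le_mul hn ih
      _ = n ^ (d + 1) := by ring

/-- The error term of Theorem 3.2 tends to `0`: `|c| (√(1280/n) + 4/n) → 0`. [folklore] -/
private theorem tendsto_err32 (C : ℝ) :
    Tendsto (fun n : ℕ => C * (Real.sqrt (1280 / n) + 4 / n)) atTop (𝓝 0) := by
  have h1 : Tendsto (fun n : ℕ => (1280 : ℝ) / n) atTop (𝓝 0) := tendsto_const_div_atTop_nhds_zero_nat _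
  have h2 : Tendsto (fun n : ℕ => Real.sqrt (1280 / n)) atTop (𝓝 0) := by
    have h := (Real.continuous_sqrt.tendsto 0).comp h1
    rwa [Real.sqrt_zero] at h
  have h3 : Tendsto (fun n : ℕ => (4 : ℝ) / n) atTop (𝓝 0) := tendsto_const_div_atTop_nhds_zero_nat _
  have h := (h2.add h3).const_mul C
  rwa [add_zero, mul_zero] at h

/-- **Chan–Lee–Raghavendra–Steurer, Theorem 3.2 — PROVED** (with `N = n^{10 f(n)}`; the proof of
p. 11: "Fix an instance size `m` and put `d = f(m)` … require that `n` grows like `m^{10d}` so that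
`η_n = o(1)`. The lower bound achieved is `n^{d/2} ≥ m^{5 f(m)²}`").  Discharges the named fact
`ChanEtAl2016_thm32` (net debt −1). [cite: ChanEtAl2016, Thm 3.2 (arXiv v3 p. 9; proof p. 11)] -/
theorem ChanEtAl2016_thm32_holds : ChanEtAl2016_thm32 := by
  classical
  intro k P c s δ f hδ hyp
  obtain ⟨n₁, hn₁⟩ := hyp
  obtain ⟨n₂, hn₂⟩ := eventually_atTop.1 ((tendsto_err32 |c|).eventually_lt_const hδ)
  refine ⟨max n₁ (max n₂ 8), fun n hn => ?_⟩
  have hnn₁ : n₁ ≤ n := le_trans (le_max_left _ _) hn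
  have hnn₂ : n₂ ≤ n := le_trans ((le_max_left _ _).trans (le_max_right _ _)) hn
  have hn8 : 8 ≤ n := le_trans ((le_max_right _ _).trans (le_max_right _ _)) hn
  obtain ⟨hd, hkd, hSA⟩ := hn₁ n hnn₁
  generalize hdd : f n = d at hd hkd hSA
  refine ⟨n ^ (10 * d), le_rfl, fun R hR L hL => ?_⟩
  obtain ⟨I, hI, pE, hgap⟩ := exists_of_not_saAchieves hSA
  -- numerics about `n` and `N = n^{10d}`
  have hn1 : 1 ≤ n := by omega
  have hn0 : (0 : ℝ) < n := by exact_mod_cast (show 0 < n by omega)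
  have hn1r : (1 : ℝ) ≤ n := by exact_mod_cast hn1
  have hN4 : 4 * n ≤ n ^ (10 * d) := by
    calc 4 * n ≤ n ^ 9 * n := by
          refine Nat.mul_le_mul_right n ?_
          calc 4 ≤ 8 ^ 9 := by norm_num
            _ ≤ n ^ 9 := Nat.pow_le_pow_left hn8 9
      _ = n ^ 10 := by ring
      _ ≤ n ^ (10 * d) := Nat.pow_le_pow_right hn1 (by omega)
  have hNreal : ((n ^ (10 * d) : ℕ) : ℝ) = (n : ℝ) ^ (10 * d) := by push_cast; ring
  have hN1 : (1 : ℝ) < ((n ^ (10 * d) : ℕ) : ℝ) := by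
    rw [hNreal]
    have h8 : (8 : ℝ) ≤ n := by exact_mod_cast hn8
    exact one_lt_pow₀ (by linarith) (by omega)
  have hN0 : (0 : ℝ) < ((n ^ (10 * d) : ℕ) : ℝ) := by linarith
  have hsqrtN : Real.sqrt ((n ^ (10 * d) : ℕ) : ℝ) = (n : ℝ) ^ (5 * d) := by
    rw [hNreal, show (n : ℝ) ^ (10 * d) = ((n : ℝ) ^ (5 * d)) ^ 2 by rw [← pow_mul]; ring_nf,
      Real.sqrt_sq (by positivity)]
  -- parameters `t = d log₂ N`, `γ² = 16 n t d/√N`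
  obtain ⟨t, ht⟩ : ∃ t : ℝ, t = d * Real.logb 2 ((n ^ (10 * d) : ℕ) : ℝ) := ⟨_, rfl⟩
  have hlogN : 0 < Real.logb 2 ((n ^ (10 * d) : ℕ) : ℝ) := Real.logb_pos one_lt_two hN1
  have hd0 : (0 : ℝ) < d := by exact_mod_cast hd
  have ht0 : 0 < t := by rw [ht]; exact mul_pos hd0 hlogN
  have hin : 0 < 16 * n * t * d / Real.sqrt ((n ^ (10 * d) : ℕ) : ℝ) := by
    rw [hsqrtN]; positivity
  obtain ⟨γ, hγ⟩ : ∃ γ : ℝ, γ = Real.sqrt (16 * n * t * d / Real.sqrt ((n ^ (10 * d) : ℕ) : ℝ)) :=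
    ⟨_, rfl⟩
  have hγ0 : 0 < γ := by rw [hγ]; exact Real.sqrt_pos.2 hin
  have hγt : 16 * n * t * d / Real.sqrt ((n ^ (10 * d) : ℕ) : ℝ) ≤ γ ^ 2 := by
    rw [hγ, Real.sq_sqrt hin.le]
  -- the factorisation, of size `R + 1 ≤ 2 n^{5d²} = 2 (√N)^d`
  have hfac := hL.hasNonnegFactorization
  have hRn : (R : ℝ) ≤ (n : ℝ) ^ (5 * d * d) := by
    have h1 : (R : ℝ) ≤ (n : ℝ) ^ (d ^ 2) := by
      rw [show ((d : ℕ) : ℝ) ^ 2 = ((d ^ 2 : ℕ) : ℝ) by push_cast; ring, Real.rpow_natCast] at hR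
      exact hR
    exact h1.trans (pow_le_pow_right₀ hn1r (by nlinarith))
  have hpow1 : (1 : ℝ) ≤ (n : ℝ) ^ (5 * d * d) := one_le_pow₀ hn1r
  have hR' : ((R + 1 : ℕ) : ℝ) ≤ 2 * Real.sqrt ((n ^ (10 * d) : ℕ) : ℝ) ^ d := by
    rw [hsqrtN, ← pow_mul, show 5 * d * d = 5 * d * d from rfl]
    push_cast
    have : (n : ℝ) ^ (5 * d * d) = (n : ℝ) ^ (5 * d * d) := rfl
    linarith
  have key := sa_value_le_of_hasNonnegFactorization (m := n) (n := n ^ (10 * d)) hd hkd hn1 hN4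
    ht0 hγ0 hγt hR' hfac I hI pE
  -- bound the error: `B ≤ 2 n^d`
  obtain ⟨B, hB⟩ : ∃ B : ℝ, B = ((univ.filter fun S : Finset (Fin n) => S.card ≤ d).card : ℝ) :=
    ⟨_, rfl⟩
  rw [← hB] at key
  have hB0 : 0 ≤ B := by rw [hB]; exact Nat.cast_nonneg _
  have hB2 : B ≤ 2 * (n : ℝ) ^ d := by
    have h := (card_filter_card_le n d).le.trans (sum_range_choose_le_one_add_pow n d)
    have h' : B ≤ ((1 + n ^ d : ℕ) : ℝ) := by rw [hB]; exact_mod_cast h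
    have hnd : (1 : ℝ) ≤ (n : ℝ) ^ d := one_le_pow₀ hn1r
    push_cast at h'
    linarith
  -- `(R+1) 2^{−t} ≤ 2 n^{5d²} / n^{10d²}`
  have h2t : (2 : ℝ) ^ (-t) = ((n : ℝ) ^ (10 * d * d))⁻¹ := by
    rw [ht, show -(↑d * Real.logb 2 (((n ^ (10 * d) : ℕ) : ℝ))) =
        Real.logb 2 (((n ^ (10 * d) : ℕ) : ℝ)) * (-(d : ℝ)) by ring,
      Real.rpow_mul zero_le_two, Real.rpow_logb two_pos (by norm_num) hN0, Real.rpow_neg hN0.le,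
      Real.rpow_natCast, hNreal, ← pow_mul]
  have hterm2 : B * (((R + 1 : ℕ) : ℝ) * (2 : ℝ) ^ (-t)) ≤ 4 / n := by
    rw [h2t]
    have hpos : (0 : ℝ) < (n : ℝ) ^ (10 * d * d) := by positivity
    have hnum : B * ((R + 1 : ℕ) : ℝ) ≤ 2 * (n : ℝ) ^ d * (2 * (n : ℝ) ^ (5 * d * d)) := by
      refine mul_le_mul hB2 ?_ (Nat.cast_nonneg _) (by positivity)
      push_cast; linarith
    have hexp : 2 * (n : ℝ) ^ d * (2 * (n : ℝ) ^ (5 * d * d)) * n ≤ 4 * (n : ℝ) ^ (10 * d * d) := by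
      have : (n : ℝ) ^ d * (n : ℝ) ^ (5 * d * d) * n = (n : ℝ) ^ (d + 5 * d * d + 1) := by ring
      have hle : (n : ℝ) ^ (d + 5 * d * d + 1) ≤ (n : ℝ) ^ (10 * d * d) :=
        pow_le_pow_right₀ hn1r (by nlinarith)
      calc 2 * (n : ℝ) ^ d * (2 * (n : ℝ) ^ (5 * d * d)) * n = 4 * (n : ℝ) ^ (d + 5 * d * d + 1) := by
            ring
        _ ≤ 4 * (n : ℝ) ^ (10 * d * d) := by linarith
    rw [← mul_assoc, mul_inv_le_iff₀ hpos, div_mul_eq_mul_div, le_div_iff₀ hn0]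
    have hRn0 : (0 : ℝ) ≤ ((R + 1 : ℕ) : ℝ) := Nat.cast_nonneg _
    calc B * ((R + 1 : ℕ) : ℝ) * n ≤ 2 * (n : ℝ) ^ d * (2 * (n : ℝ) ^ (5 * d * d)) * n :=
          mul_le_mul_of_nonneg_right hnum hn0.le
      _ ≤ 4 * (n : ℝ) ^ (10 * d * d) := hexp
  -- `B γ ≤ √(1280/n)`
  have hlogb : Real.logb 2 (n : ℝ) ≤ 2 * n := by
    rw [Real.logb, div_le_iff₀ (Real.log_pos one_lt_two)]
    have h1 := Real.log_le_sub_one_of_pos hn0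
    have h2 := Real.log_two_gt_d9
    nlinarith
  have hγsq : γ ^ 2 = 160 * (d : ℝ) ^ 3 * n * Real.logb 2 n / (n : ℝ) ^ (5 * d) := by
    rw [hγ, Real.sq_sqrt hin.le, hsqrtN, ht, hNreal]
    simp only [Real.logb, Real.log_pow]
    push_cast
    field_simp
    ring
  have hterm1 : B * γ ≤ Real.sqrt (1280 / n) := by
    refine (le_abs_self _).trans (Real.abs_le_sqrt ?_)
    have hcube : (d : ℝ) ^ 3 * n ≤ (n : ℝ) ^ d := by exact_mod_cast cube_mul_le_pow hn8 hd
    have hpos : (0 : ℝ) < (n : ℝ) ^ (5 * d) := by positivity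
    have hlog0 : 0 ≤ Real.logb 2 (n : ℝ) := Real.logb_nonneg one_lt_two hn1r
    have hsq : (B * γ) ^ 2 ≤ (2 * (n : ℝ) ^ d) ^ 2 * γ ^ 2 := by
      rw [mul_pow]
      exact mul_le_mul_of_nonneg_right (pow_le_pow_left₀ hB0 hB2 2) (sq_nonneg γ)
    have hnum : (2 * (n : ℝ) ^ d) ^ 2 * (160 * (d : ℝ) ^ 3 * n * Real.logb 2 n) ≤
        1280 * (n : ℝ) ^ (3 * d + 1) := by
      have h1 : (d : ℝ) ^ 3 * n * Real.logb 2 n ≤ (n : ℝ) ^ d * (2 * n) :=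
        mul_le_mul hcube hlogb hlog0 (by positivity)
      calc (2 * (n : ℝ) ^ d) ^ 2 * (160 * (d : ℝ) ^ 3 * n * Real.logb 2 n)
          = 640 * (n : ℝ) ^ (2 * d) * ((d : ℝ) ^ 3 * n * Real.logb 2 n) := by ring
        _ ≤ 640 * (n : ℝ) ^ (2 * d) * ((n : ℝ) ^ d * (2 * n)) :=
            mul_le_mul_of_nonneg_left h1 (by positivity)
        _ = 1280 * (n : ℝ) ^ (3 * d + 1) := by ring
    have hle : (n : ℝ) ^ (3 * d + 2) ≤ (n : ℝ) ^ (5 * d) := pow_le_pow_right₀ hn1r (by omega)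
    calc (B * γ) ^ 2 ≤ (2 * (n : ℝ) ^ d) ^ 2 * γ ^ 2 := hsq
      _ = (2 * (n : ℝ) ^ d) ^ 2 * (160 * (d : ℝ) ^ 3 * n * Real.logb 2 n) / (n : ℝ) ^ (5 * d) := by
          rw [hγsq]; exact (mul_div_assoc _ _ _).symm
      _ ≤ 1280 * (n : ℝ) ^ (3 * d + 1) / (n : ℝ) ^ (5 * d) :=
          div_le_div_of_nonneg_right hnum hpos.le
      _ ≤ 1280 / n := by
          rw [div_le_div_iff₀ hpos hn0]
          calc 1280 * (n : ℝ) ^ (3 * d + 1) * n = 1280 * (n : ℝ) ^ (3 * d + 2) := by ring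
            _ ≤ 1280 * (n : ℝ) ^ (5 * d) := by linarith
  -- conclude
  have herr := hn₂ n hnn₂
  have hmain : c * B * (γ + ((R + 1 : ℕ) : ℝ) * (2 : ℝ) ^ (-t)) < δ := by
    have hg0 : 0 ≤ γ + ((R + 1 : ℕ) : ℝ) * (2 : ℝ) ^ (-t) := by positivity
    calc c * B * (γ + ((R + 1 : ℕ) : ℝ) * (2 : ℝ) ^ (-t))
        ≤ |c| * (B * γ + B * (((R + 1 : ℕ) : ℝ) * (2 : ℝ) ^ (-t))) := by
          have : c * B * (γ + ((R + 1 : ℕ) : ℝ) * (2 : ℝ) ^ (-t)) ≤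
              |c| * B * (γ + ((R + 1 : ℕ) : ℝ) * (2 : ℝ) ^ (-t)) := by
            gcongr; exact le_abs_self c
          linarith
      _ ≤ |c| * (Real.sqrt (1280 / n) + 4 / n) := by
          refine mul_le_mul_of_nonneg_left ?_ (abs_nonneg c)
          linarith
      _ < δ := herr
  have : pE.E I.val < pE.E I.val := by
    calc pE.E I.val ≤ c + c * B * (γ + ((R + 1 : ℕ) : ℝ) * (2 : ℝ) ^ (-t)) := key
      _ < c + δ := by linarith
      _ < pE.E I.val := hgap
  exact lt_irrefl _ this

/-- **Quasi-polynomial LP lower bounds from linear-round Sherali–Adams gaps (UNCONDITIONAL)** —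
Thm 3.2 with `f(n) = ⌊c_ε n⌋` (p. 9: "by choosing `f(n) ≍ n^ε` … LPs of size `n^{o(log n/log log n)}`";
here the raw form): if for every `ε > 0` the `⌊c_ε n⌋`-round Sherali–Adams relaxation of Max-`𝒫`
fails to `(1 − ε, s₀ + ε)`-approximate for all large `n`, then for every `ε > 0` there are `c' > 0`
and `n₀` such that for all `n ≥ n₀` some `N ≤ n^{10⌊c' n⌋}` admits no LP relaxation of size
`≤ n^{⌊c' n⌋²}` achieving a `(1 − ε, s₀ + ε)`-approximation on `N`-variable instances.
[cite: ChanEtAl2016, Thm 3.2 and the sentence after it (arXiv v3 p. 9)] -/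
theorem quasipoly_lp_of_linearSAGap {k : ℕ} (hk : 1 ≤ k) (P : Set ((Fin k → Bool) → Bool)) {s₀ : ℝ}
    (hSAgap : ∀ ε : ℝ, 0 < ε → ∃ cε : ℝ, 0 < cε ∧ ∃ n₀ : ℕ, ∀ n : ℕ, n₀ ≤ n →
      ¬ SAAchieves (n := n) P ⌊cε * n⌋₊ (1 - ε) (s₀ + ε))
    {ε : ℝ} (hε : 0 < ε) :
    ∃ c' : ℝ, 0 < c' ∧ ∃ n₀ : ℕ, ∀ n : ℕ, n₀ ≤ n → ∃ N : ℕ, N ≤ n ^ (10 * ⌊c' * n⌋₊) ∧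
      ∀ R : ℕ, (R : ℝ) ≤ (n : ℝ) ^ ((⌊c' * n⌋₊ : ℝ) ^ 2) →
        ∀ L : LPRelaxation k N P R, ¬ L.Achieves (1 - ε) (s₀ + ε) := by
  obtain ⟨cε, hcε, n₁, H⟩ := hSAgap (ε / 2) (by positivity)
  refine ⟨cε, hcε, ?_⟩
  -- the hypothesis of Thm 3.2 with margin `δ = ε/2`, `f(n) = ⌊c_ε n⌋`
  have hyp : ∃ n₂ : ℕ, ∀ n : ℕ, n₂ ≤ n → 1 ≤ ⌊cε * n⌋₊ ∧ k ≤ ⌊cε * n⌋₊ ∧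
      ¬ SAAchieves (n := n) P ⌊cε * n⌋₊ ((1 - ε) + ε / 2) (s₀ + ε) := by
    refine ⟨max n₁ ⌈(k : ℝ) / cε⌉₊, fun n hn => ?_⟩
    have hn₁ : n₁ ≤ n := le_trans (le_max_left _ _) hn
    have hkn : k ≤ ⌊cε * n⌋₊ := by
      refine Nat.le_floor ?_
      have h1 : (k : ℝ) / cε ≤ ⌈(k : ℝ) / cε⌉₊ := Nat.le_ceil _
      have h2 : (⌈(k : ℝ) / cε⌉₊ : ℝ) ≤ n := by exact_mod_cast le_trans (le_max_right _ _) hn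
      calc (k : ℝ) = cε * ((k : ℝ) / cε) := by field_simp
        _ ≤ cε * n := by gcongr; exact h1.trans h2
    refine ⟨hk.trans hkn, hkn, fun hSA => H n hn₁ ?_⟩
    -- `(1 − ε/2, s₀ + ε/2)`-achievement follows from `(1 − ε + ε/2, s₀ + ε)`-achievement
    intro I hI pE'
    have := hSA I (hI.mono (by linarith)) pE'
    linarith
  exact ChanEtAl2016_thm32_holds k P (1 - ε) (s₀ + ε) (ε / 2) (fun n => ⌊cε * n⌋₊) (by positivity) hyp

/-! ### §3.4: the nonnegative-rank form -/

/-- A nonnegatively factorised matrix has nonnegative entries. [folklore] -/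
private theorem nonneg_of_hasNonnegFactorization {ι κ : Type*} {M : ι → κ → ℝ} {r : ℕ}
    (h : HasNonnegFactorization M r) (i : ι) (j : κ) : 0 ≤ M i j := by
  obtain ⟨U, V, hU, hV, hM⟩ := h
  rw [hM]
  exact sum_nonneg fun l _ => mul_nonneg (hU i l) (hV l j)

/-- **Chan–Lee–Raghavendra–Steurer §3.4: Theorem 3.1 in nonnegative-rank form — PROVED.**  "The
lower bounds of Thm 3.1 can be stated equivalently in terms of nonnegative rank": if the `d`-round
Sherali–Adams relaxation (`d ≥ max(1,k)`) cannot achieve a `(c,s)`-approximation on `m`-variable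
instances of Max-`𝒫`, then for all large `n` the matrix `M^{n,𝒫}_{c,s} = (c − ℑ(x))_{opt(ℑ) ≤ s, x}` has
no nonnegative factorisation of size `R ≤ n^{d/2} + 1`, i.e. `rank_+(M^{n,𝒫}_{c,s}) > n^{d/2} + 1`
(printed for Max Cut: "`rank_+(M) ≥ n^{Ω(log n/log log n)}`", via Thm 3.2).
[cite: ChanEtAl2016, §3.4 (arXiv v3 p. 11) with Thm 3.1 (p. 9)] -/
theorem ChanEtAl2016_thm31_nnr {k d : ℕ} {P : Set ((Fin k → Bool) → Bool)} {c s : ℝ}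
    (hd : 1 ≤ d) (hkd : k ≤ d) {m : ℕ} (hSA : ¬ SAAchieves (n := m) P d c s) :
    ∃ n₀ : ℕ, ∀ n : ℕ, n₀ ≤ n → ∀ R : ℕ, (R : ℝ) ≤ (n : ℝ) ^ ((d : ℝ) / 2) + 1 →
      ¬ HasNonnegFactorization (cspMatrix k n P c s) R := by
  classical
  obtain ⟨I, hI, pE, hgap⟩ := exists_of_not_saAchieves hSA
  rcases Nat.eq_zero_or_pos m with hm0 | hm
  · -- no variables: the planted row has the negative entry `c − v`
    subst hm0
    have hconst : I.val = fun _ => I.val (fun i => i.elim0) := by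
      funext x; congr 1; funext i; exact i.elim0
    have hv : c < I.val (fun i => i.elim0) := by
      rw [hconst, SAPseudoexpectation.map_const] at hgap; exact hgap
    refine ⟨0, fun n _ R _ hfac => ?_⟩
    let e : Fin 0 ↪ Fin n := ⟨fun i => i.elim0, fun i => i.elim0⟩
    have h := nonneg_of_hasNonnegFactorization hfac ⟨I.plant e, hI.plant e⟩ (fun _ => false)
    simp only [cspMatrix, CSPInstance.plant_val] at h
    have : I.val ((fun _ => false) ∘ e) = I.val (fun i => i.elim0) := by rw [hconst]
    linarith
  -- `m ≥ 1`: the engine with `t = d log₂ n`, `γ_n² = 16 m t d/√n`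
  set B : ℝ := ((univ.filter fun S : Finset (Fin m) => S.card ≤ d).card : ℝ) with hB
  have hB0 : 0 ≤ B := Nat.cast_nonneg _
  set δ : ℝ := pE.E I.val - c with hδ
  have hδ0 : 0 < δ := by rw [hδ]; linarith
  have hlim := (tendsto_err m d hd).const_mul (|c| * B)
  rw [mul_zero] at hlim
  obtain ⟨n₁, hn₁⟩ := eventually_atTop.1 (hlim.eventually_lt_const hδ0)
  refine ⟨max n₁ (4 * m), fun n hn R hR hfac => ?_⟩
  have hn₁n : n₁ ≤ n := le_trans (le_max_left _ _) hn
  have h4m : 4 * m ≤ n := le_trans (le_max_right _ _) hn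
  have hn2 : (2 : ℝ) ≤ n := by exact_mod_cast (show 2 ≤ n by omega)
  have hn0 : (0 : ℝ) < n := by linarith
  have hn1 : (1 : ℝ) < n := by linarith
  -- parameters
  set t : ℝ := d * Real.logb 2 n with ht
  have hlog : 0 < Real.logb 2 n := Real.logb_pos one_lt_two hn1
  have ht0 : 0 < t := by rw [ht]; exact mul_pos (by exact_mod_cast hd) hlog
  have hin : 0 < 16 * m * t * d / Real.sqrt n := by
    have : (0 : ℝ) < m := by exact_mod_cast hm
    have : (0 : ℝ) < d := by exact_mod_cast hd
    positivity
  set γ : ℝ := Real.sqrt (16 * m * t * d / Real.sqrt n) with hγ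
  have hγ0 : 0 < γ := Real.sqrt_pos.2 hin
  have hγt : 16 * m * t * d / Real.sqrt n ≤ γ ^ 2 := by rw [hγ, Real.sq_sqrt hin.le]
  have hR' : (R : ℝ) ≤ 2 * Real.sqrt n ^ d := by
    rw [← rpow_half_eq_sqrt_pow]
    have : (1 : ℝ) ≤ (n : ℝ) ^ ((d : ℝ) / 2) := Real.one_le_rpow hn1.le (by positivity)
    linarith
  have key := sa_value_le_of_hasNonnegFactorization hd hkd hm h4m ht0 hγ0 hγt hR' hfac I hI pE
  -- `R 2^{−t} ≤ 2 n^{−d/2}`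
  have h2t : (2 : ℝ) ^ (-t) = (n : ℝ) ^ (-(d : ℝ)) := by
    rw [ht, show -(↑d * Real.logb 2 ↑n) = Real.logb 2 n * (-(d : ℝ)) by ring,
      Real.rpow_mul zero_le_two, Real.rpow_logb two_pos (by norm_num) hn0]
  have hRt : (R : ℝ) * (2 : ℝ) ^ (-t) ≤ 2 * (n : ℝ) ^ (-((d : ℝ) / 2)) := by
    rw [h2t]
    have hnd : 0 < (n : ℝ) ^ (-(d : ℝ)) := Real.rpow_pos_of_pos hn0 _
    have h1 : (R : ℝ) ≤ 2 * (n : ℝ) ^ ((d : ℝ) / 2) := by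
      have : (1 : ℝ) ≤ (n : ℝ) ^ ((d : ℝ) / 2) := Real.one_le_rpow hn1.le (by positivity)
      linarith
    calc (R : ℝ) * (n : ℝ) ^ (-(d : ℝ)) ≤ 2 * (n : ℝ) ^ ((d : ℝ) / 2) * (n : ℝ) ^ (-(d : ℝ)) :=
          mul_le_mul_of_nonneg_right h1 hnd.le
      _ = 2 * (n : ℝ) ^ (-((d : ℝ) / 2)) := by
          rw [mul_assoc, ← Real.rpow_add hn0]; congr 1; ring_nf
  -- the error is below `δ`
  have herr := hn₁ n hn₁n
  have hg0 : 0 ≤ γ + (R : ℝ) * (2 : ℝ) ^ (-t) := by positivity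
  have hmain : c * B * (γ + (R : ℝ) * (2 : ℝ) ^ (-t)) < δ := by
    calc c * B * (γ + (R : ℝ) * (2 : ℝ) ^ (-t))
        ≤ |c| * B * (γ + (R : ℝ) * (2 : ℝ) ^ (-t)) := by
          gcongr; exact le_abs_self c
      _ ≤ |c| * B * (Real.sqrt (16 * m * (d * Real.logb 2 n) * d / Real.sqrt n) +
            2 * (n : ℝ) ^ (-((d : ℝ) / 2))) := by
          refine mul_le_mul_of_nonneg_left ?_ (mul_nonneg (abs_nonneg c) hB0)
          have : γ = Real.sqrt (16 * m * (d * Real.logb 2 n) * d / Real.sqrt n) := by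
            rw [hγ, ht]
          rw [← this]; linarith
      _ < δ := herr
  have : pE.E I.val < pE.E I.val := by
    calc pE.E I.val ≤ c + c * B * (γ + (R : ℝ) * (2 : ℝ) ^ (-t)) := key
      _ < c + δ := by linarith
      _ = pE.E I.val := by rw [hδ]; ring
  exact lt_irrefl _ this

/-- **Nonnegative rank of the Max-`k`-SAT matrices, UNCONDITIONAL** (`k ≥ 3`): for every `ε > 0` and
`d ≥ k`, for all large `n`, the matrix `M^{n}_{1−ε, 1−2^{−k}+ε}` (rows: Max-`k`-SAT instances on `n`
variables with `opt ≤ 1 − 2^{−k} + ε`; columns: assignments; entries `1 − ε − ℑ(x)`) has no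
nonnegative factorisation of size `≤ n^{d/2} + 1` — the [CLRS13] separation of nonnegative rank from
smooth/approximate nonnegative rank (§1.1, §3.4) for an explicit family, in the tree.
[cite: ChanEtAl2016, §3.4 (arXiv v3 p. 11) and §1.1 (p. 4: "first separation between nonnegative rank and smooth nonnegative rank")] -/
theorem maxKSat_nnr {k : ℕ} (hk : 3 ≤ k) {ε : ℝ} (hε : 0 < ε) {d : ℕ} (hkd : k ≤ d) :
    ∃ n₀ : ℕ, ∀ n : ℕ, n₀ ≤ n → ∀ R : ℕ, (R : ℝ) ≤ (n : ℝ) ^ ((d : ℝ) / 2) + 1 →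
      ¬ HasNonnegFactorization (cspMatrix k n (maxKSatPreds k) (1 - ε) (1 - 1 / 2 ^ k + ε)) R := by
  obtain ⟨cε, hcε, n₁, H⟩ := Schoenebeck2008_maxKSatSA hk ε hε
  -- an instance size `m` with `⌊c_ε m⌋ ≥ d`
  set m : ℕ := max n₁ ⌈(d : ℝ) / cε⌉₊ with hm
  have hdm : d ≤ ⌊cε * m⌋₊ := by
    refine Nat.le_floor ?_
    have h1 : (d : ℝ) / cε ≤ ⌈(d : ℝ) / cε⌉₊ := Nat.le_ceil _
    have h2 : (⌈(d : ℝ) / cε⌉₊ : ℝ) ≤ m := by rw [hm]; exact_mod_cast le_max_right _ _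
    calc (d : ℝ) = cε * ((d : ℝ) / cε) := by field_simp
      _ ≤ cε * m := by gcongr; exact h1.trans h2
  exact ChanEtAl2016_thm31_nnr (by omega) hkd (not_saAchieves_of_le (H m (le_max_left _ _)) hdm)

/-! ### Both directions together (Theorem 3.1 with §2.1, `SheraliAdamsAsLpRelaxation.lean`) -/

/-- **LP ⇄ Sherali–Adams bootstrapping (Theorem 3.1 with §2.1).**  Let `1 ≤ d`, `k ≤ d`, `c, s ∈ ℝ`.
If for infinitely many `n` some LP relaxation of size `≤ n^{d/2}` achieves a `(c,s)`-approximation on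
`n`-variable instances of Max-`𝒫`, then the `d`-round Sherali–Adams relaxation achieves a
`(c,s)`-approximation on `m`-variable instances for EVERY `m` (the contrapositive of Theorem 3.1,
`ChanEtAl2016_thm31_holds`). [cite: ChanEtAl2016, Thm 3.1 (arXiv v3 p. 9)] -/
theorem saAchieves_of_frequently_lp {k d : ℕ} {P : Set ((Fin k → Bool) → Bool)} {c s : ℝ}
    (hd : 1 ≤ d) (hkd : k ≤ d)
    (h : ∀ n₀ : ℕ, ∃ n, n₀ ≤ n ∧ ∃ R : ℕ, (R : ℝ) ≤ (n : ℝ) ^ ((d : ℝ) / 2) ∧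
      ∃ L : LPRelaxation k n P R, L.Achieves c s)
    (m : ℕ) : SAAchieves (n := m) P d c s := by
  by_contra hSA
  obtain ⟨n₀, hn₀⟩ := ChanEtAl2016_thm31_holds k d P c s hd hkd m hSA
  obtain ⟨n, hn, R, hR, L, hL⟩ := h n₀
  exact hn₀ n hn R hR L hL

/-- **Polynomial-size LPs and constant-round Sherali–Adams have the same power, up to the polynomial
`n^{d/2} ↦ (1 + n^d)² + 2`.**  Under the hypothesis of `saAchieves_of_frequently_lp` (LPs of size
`≤ n^{d/2}` achieving `(c,s)` for infinitely many `n`), for EVERY `m` the explicit Sherali–Adams LP of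
§2.1 (`SALp.relaxation`, `ChanEtAl2016_lp_of_saAchieves`), of size `≤ (1 + m^d)² + 2`, achieves a
`(c,s)`-approximation on `m`-variable instances ("if `d`-rounds of Sherali–Adams achieve a
`(c,s)`-approximation for `Π_n`, then so do general `n^{O(d)}`-sized LP relaxations").
[cite: ChanEtAl2016, Thm 3.1 with §2.1 (arXiv v3 pp. 8–9)] -/
theorem poly_lp_everywhere_of_frequently_lp {k d : ℕ} {P : Set ((Fin k → Bool) → Bool)} {c s : ℝ}
    (hd : 1 ≤ d) (hkd : k ≤ d)
    (h : ∀ n₀ : ℕ, ∃ n, n₀ ≤ n ∧ ∃ R : ℕ, (R : ℝ) ≤ (n : ℝ) ^ ((d : ℝ) / 2) ∧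
      ∃ L : LPRelaxation k n P R, L.Achieves c s)
    (m : ℕ) : ∃ R : ℕ, R ≤ (1 + m ^ d) ^ 2 + 2 ∧ ∃ L : LPRelaxation k m P R, L.Achieves c s :=
  ChanEtAl2016_lp_of_saAchieves hkd (saAchieves_of_frequently_lp hd hkd h m)

end Literature.Combinatorics.Optimization

end
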